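import Mathlib
import HarnessLib
import Summits.HubbardSuperconductivity.HubbardSuperconductivity.Theorems.KLProgrammeKLRegimeEngineFrameLevelCount
import Summits.HubbardSuperconductivity.HubbardSuperconductivity.Theorems.KLProgrammeKLRegimeSplitDefs
import Literature.MathematicalPhysics.QuantumLattice.HubbardCTScaleZeroDetBound
import Literature.MathematicalPhysics.QuantumLattice.InfraredCutoffGramConstant

/-!
# Route `KLProgramme` — crux K3 ENGINE (19662 / gen-3 `KLRegimeEngineV11`), stub `stub_engine_scale0`: the scale-`0` covariance of the
# carrier is determinant-bounded with an ABSOLUTE constant for every admissible frame — uniformly in `β ≥ 128`, `L ≥ max(2^{15}, β)`, `M`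
# (cell gate-hubbard-kl, seat hubbard-kl-k3c2-p1; technique «scale-0 Gram step», the `κ² ≍ (1/π) log M` obstruction retired)

Composition of the landed chain: `FrameOK` ⇒ frame-band level count (`card_filter_nambuXiCT_lt_le_of_frameOK`, absolute `c₁ = 2200`,
`c₂ = 200000`) ⇒ infrared Gram constant `κ_IR² ≤ 7c₁e₀ + (e₀ + 8)c₂ ≤ 1606732` (`sum_one_sub_hubbardCutoffWeightCT_div_sqrt_le`, needs
`π/β ≤ e₀` and `β ≤ L`) ⇒ `IsDetBoundedR q (Sᵀ C^K_{>e₀} S) √(2(7 + κ_IR²))` on the `4M` time grid (`isDetBoundedR_gridSub_hubbardCovAboveCT`,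
de Siqueira Pedra–Salmhofer's determinant bound; every `M`).  This is the covariance hypothesis of the single determinant-bounded Gaussian step
(`GrassmannEffectiveActionBoundDB.sum_norm_kernel_effAction_le_of_gramBounded` via `IsDetBoundedR.isGramBoundedR`) for
`klEffectiveAction … 0 = effAction C^K_{>e₀} (V + 𝒩_K)`.  Plus the `IsGramBoundedR` form (`isGramBoundedR_scaleZero_of_frameOK`, via the charge lemma
`gridSub_hubbardCovAboveCT_apply_of_charge_eq` and `IsDetBoundedR.isGramBoundedR`) — the literal hypothesis of the step theorem.
-/

noncomputable section

namespace Summit.HubbardSuperconductivity.HubbardSuperconductivity.Theorems.EngineV8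

set_option linter.dupNamespace false

open Real Finset Literature.MathematicalPhysics.QuantumLattice Literature.Probability.LatticeModels
open Summit.HubbardSuperconductivity.HubbardSuperconductivity.Theorems.KLRegimeSplit

/-- **The scale-`0` covariance of the KL carrier is determinant-bounded with an absolute constant.**  For every admissible frame
(`FrameOK R U N μ K`), `klBetaMin ≤ β ≤ L`, `2^{15} ≤ L` and every Matsubara cutoff `M ≥ 1`:
`IsDetBoundedR q ((hubbardGridSub L M β (4M))ᵀ · hubbardCovAboveCT L M β μ 0 K e₀ · hubbardGridSub L M β (4M)) √(2·(7 + 1606732))`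
(charge-`0` legs as rows) — no `log M`, no `log β`. -/
theorem isDetBoundedR_scaleZero_of_frameOK {R : RenConsts} {U : ℝ} {N : ℕ} {μ : ℝ} {K : TrigPolyC4v} (hK : FrameOK R U N μ K)
    {β : ℝ} (hβ : klBetaMin ≤ β) {L M : ℕ} [NeZero L] [NeZero M] (hL : (2 : ℝ) ^ 15 ≤ L) (hβL : β ≤ L) :
    IsDetBoundedR (fun X : GridLeg (GridPoint L (2 * (2 * M))) => decide (X.2 = 0))
      ((hubbardGridSub L M β (2 * (2 * M))).transpose * hubbardCovAboveCT L M β μ 0 K klE0 * hubbardGridSub L M β (2 * (2 * M)))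
      (Real.sqrt (2 * (7 + 1606732))) := by
  have hβpos : 0 < β := lt_of_lt_of_le (by norm_num [klBetaMin]) hβ
  have hLpos : (0 : ℝ) < L := by exact_mod_cast Nat.pos_of_ne_zero (NeZero.ne L)
  have he₀ : (0 : ℝ) < klE0 := by norm_num [klE0]
  have hπβ : Real.pi / β ≤ klE0 := by
    rw [div_le_iff₀ hβpos, klE0]
    have h128 : (128 : ℝ) ≤ β := by simpa [klBetaMin] using hβ
    nlinarith [Real.pi_lt_four]
  -- the DOS count of the frame band
  have hcount : ∀ η : ℝ, 0 < η → η ≤ klE0 →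
      (((univ.filter fun k : TorusSite 2 L => |nambuXiCT L μ K k| < η).card : ℕ) : ℝ) ≤ 2200 * η * (L : ℝ) ^ 2 + 200000 * L := by
    intro η hη hηe
    exact card_filter_nambuXiCT_lt_le_of_frameOK hK L hL hη.le (by simpa [klE0] using hηe)
  -- the infrared Gram constant
  have hsum := sum_one_sub_hubbardCutoffWeightCT_div_sqrt_le (M := M) hβpos μ K he₀ hπβ hβL (by norm_num : (0 : ℝ) ≤ 2200)
    (by norm_num : (0 : ℝ) ≤ 200000) hcount
  have hκ : 1 / (β * (L : ℝ) ^ 2) * ∑ k : FreqMomentum L M,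
      (1 - hubbardCutoffWeightCT L M β μ K klE0 k) / Real.sqrt (matsubaraFreq β M k.1 ^ 2 + nambuXiCT L μ K k.2 ^ 2) ≤
        (Real.sqrt 1606732) ^ 2 := by
    rw [Real.sq_sqrt (by norm_num)]
    have hβL2 : 0 < β * (L : ℝ) ^ 2 := by positivity
    rw [one_div, inv_mul_le_iff₀ hβL2]
    refine hsum.trans ?_
    rw [klE0]
    nlinarith
  have h := isDetBoundedR_gridSub_hubbardCovAboveCT (L := L) (M := M) hβpos μ K klE0 hκ
  rwa [Real.sq_sqrt (by norm_num)] at h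

/-- The pulled-back scale-`0` covariance is CHARGED for the charge map `q X = [X.2 = 0]`: legs of equal charge do not pair (the seed is `0`,
so the covariance is normal). -/
theorem gridSub_hubbardCovAboveCT_apply_of_charge_eq (β μ : ℝ) (K : TrigPolyC4v) (Λ : ℝ) {L M : ℕ} [NeZero L] (N : ℕ)
    {X Y : GridLeg (GridPoint L N)}
    (h : (fun Z : GridLeg (GridPoint L N) => decide (Z.2 = 0)) X = (fun Z : GridLeg (GridPoint L N) => decide (Z.2 = 0)) Y) :
    ((hubbardGridSub L M β N).transpose * hubbardCovAboveCT L M β μ 0 K Λ * hubbardGridSub L M β N) X Y = 0 := by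
  have hXY : X.2 = Y.2 := by
    have h' : decide (X.2 = 0) = decide (Y.2 = 0) := h
    rcases Fin.eq_zero_or_eq_succ X.2 with hx | ⟨i, hx⟩ <;> rcases Fin.eq_zero_or_eq_succ Y.2 with hy | ⟨j, hy⟩
    · rw [hx, hy]
    · exfalso; rw [hx, hy] at h'; simp [Fin.succ_ne_zero] at h'
    · exfalso; rw [hx, hy] at h'; simp [Fin.succ_ne_zero] at h'
    · rw [hx, hy, Fin.eq_zero i, Fin.eq_zero j]
  rw [hubbardCovAboveCT_zero_seed, hubbardGridSub]
  exact gridSub_pullback_normalCovariance_apply_of_charge_eq β _ _ _ hXY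

/-- **The scale-`0` covariance of the KL carrier is replica-Gram-bounded with an absolute constant** — the literal covariance hypothesis of
the single-scale step `GrassmannEffectiveActionBoundDB.sum_norm_kernel_effAction_le_of_gramBounded` for `effAction C^K_{>e₀} (V + 𝒩_K)` on the
`4M` grid: for every admissible frame, `klBetaMin ≤ β ≤ L`, `2^{15} ≤ L`, every `M ≥ 1`,
`IsGramBoundedR ((hubbardGridSub L M β (4M))ᵀ · hubbardCovAboveCT L M β μ 0 K e₀ · hubbardGridSub L M β (4M)) √(2·(7 + 1606732))`. -/
theorem isGramBoundedR_scaleZero_of_frameOK {R : RenConsts} {U : ℝ} {N : ℕ} {μ : ℝ} {K : TrigPolyC4v} (hK : FrameOK R U N μ K)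
    {β : ℝ} (hβ : klBetaMin ≤ β) {L M : ℕ} [NeZero L] [NeZero M] (hL : (2 : ℝ) ^ 15 ≤ L) (hβL : β ≤ L) :
    IsGramBoundedR
      ((hubbardGridSub L M β (2 * (2 * M))).transpose * hubbardCovAboveCT L M β μ 0 K klE0 * hubbardGridSub L M β (2 * (2 * M)))
      (Real.sqrt (2 * (7 + 1606732))) :=
  (isDetBoundedR_scaleZero_of_frameOK hK hβ hL hβL).isGramBoundedR
    (fun _ _ h => gridSub_hubbardCovAboveCT_apply_of_charge_eq β μ K klE0 (2 * (2 * M)) h) (Real.sqrt_nonneg _)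

end Summit.HubbardSuperconductivity.HubbardSuperconductivity.Theorems.EngineV8

end
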